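import Literature.NumberTheory.LFunctions.Zhang2022.KnifeEdgeLenSiegelTransfer

/-!
# Zhang (2022), rung F-S3 (Landau–Siegel programme, §D edge len = E*-len⁺): card `siegel-model-family-index`
# (ls-knife-len-idea-2) — its REAL FIRST RUNG per the critic: the composite-family SLOTS (bare `Prop`s) and the
# PROVED implication «K1 ∧ Siegel slot ∧ sup hypothesis ⇒ Zhang's prime-family slot» (→ row E-002)

Y. Zhang, *Discrete mean estimates and the Landau–Siegel zero*, arXiv:2211.02515v1 [Zhang2022LandauSiegel] —
an unrefereed manuscript under adjudication; T. Tao, J. Teräväinen [TaoTeravainen2021] (the Siegel model).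
**WHAT THIS IS NOT: not a claim about Theorems 1–2 of arXiv:2211.02515, about
Landau–Siegel zeros, or about Parity. The programme SEARCHES and TYPES; no claim about Landau–Siegel zeros,
Theorems 1–2 of arXiv:2211.02515 or a repaired Margin232 until a kernel theorem says so. `SiegelInClassMean`,
`SiegelCrossMean`, `SiegelOverhangMean` (the card's K2 objects for the LINEARISED family) and `InClassSliceSup`,
`CrossSliceSup`, `OverhangSliceSup` (the referee's sup/avg currency condition) are bare `Prop`s — statement SHAPES,
asserted by no one; K1 `SiegelModuliTransfer c` stays a hypothesis; every `theorem` is an implication between them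
and the tree's prime-family slots `KnifeEdge.InClassMean/CrossMean/OverhangMean` (p461073).**

THE CRITIC'S WORK ORDER (ls-knife-crit-1, 2026-08-26T21:28Z, verdict new-combination KEPT OPEN): «the card's len rung
is (a) K1 `SiegelModuliTransfer c` with `c` pinned `> 0` and (b) the implication shape `SiegelModuliTransfer c →
⟨slot for the (χ∗log)ν_R-weighted composite family at θ ∈ (1,2): InClassMean/CrossMean/OverhangMean analogues over
moduliWindow with weight siegelModulusWeight⟩ → KnifeEdge.CrossMean c' θ X 𝒱 / OverhangMean for Zhang's prime family`
— type the COMPOSITE-FAMILY SLOT as a bare Prop and PROVE the transfer implication from K1 (sup/avg bookkeeping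
explicit: hypothesis sup_m G ≤ 𝓛^{c−1}·avg)». Done here:
* Part 1. The three Siegel slots over `discMeanS`/`discPolarS` (density `w(m) = Λ_Siegel(m)/log m`, i.e. the critic's
  `siegelModulusWeight` normalised by the constant-to-first-order `log m = 𝓛⁹(1 + O(𝓛⁻⁷⁷))`, so that primes enter
  with density exactly `1`, `siegelDensity_prime`), normaliser `𝔓_S = frakPS`; smooth cutoff `ψc` a parameter.
* Part 1 (cont.). The three sup hypotheses: at EVERY modulus `m` of the window the `Ψ₁(m)`-slice is
  `≤ 𝓛^κ·𝔞·P` (= `𝓛^κ` × one prime modulus's share of a main term `k𝔞𝔓`).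
* Part 2 (PROVED). `crossMean_of_siegel`: `0 < c → κ < c → SiegelModuliTransfer c → IsSmoothCutoff ψc →
  SiegelCrossMean c' ψc θ X 𝒱 → CrossSliceSup c' κ θ 𝒱 → CrossMean c' θ X 𝒱`; likewise `overhangMean_of_siegel`,
  `inClassMean_of_siegel`; and the composition into the row of record `eStarLenPlusShape_of_siegel`
  (`EStarLenPlusShape c' θ X 𝒱`, E-002, via `eStarLenPlusShape_of_slots`). The referee's objection (ls-ref-1
  21:21Z: beyond the wall the sup hypothesis is itself of E*-len⁺ strength) is thereby a statement about ONE named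
  hypothesis of a kernel implication, `CrossSliceSup`/`OverhangSliceSup`, not about the bookkeeping.

Typer: ls-knife-typer-1 (cell landau-siegel §D).

## References
* Y. Zhang, arXiv:2211.02515v1 (2022), §2 (2.16)–(2.17), §7 Prop 7.1 (7.2), §8 (8.3)–(8.5), (8.23).
  [cite: Zhang2022LandauSiegel, §2, §7, §8]
* T. Tao, J. Teräväinen, arXiv:2109.06291, §5 Prop. 5.2. [cite: TaoTeravainen2021, §5]
-/

noncomputable section

open Finset Real Complex ComplexConjugate

namespace Literature.NumberTheory.LFunctions.Zhang2022.KnifeEdge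

open Skeleton Repair
open Literature.Barriers.Parity.TaoTeravainen (IsSmoothCutoff)

variable {D : ℕ}

/-! ### Part 1 — the card's composite-family SLOTS (bare `Prop`s, OPEN) and the sup hypotheses (bare `Prop`s) -/

section SiegelSlots

variable (c' : ℝ) (ψc : ℝ → ℝ)

/-- **SIEGEL IN-CLASS SLOT (shape, NOT asserted — the card's K2 object for the in-class block):** under (A),
eventually in `D`, the Siegel family's discrete mean (every modulus `m` of the window, density `w(m) = Λ_Siegel(m)/log m`,
smooth cutoff `ψc`) of the length-`P` polynomial of one kinked in-class profile `u` is `𝔅(u)·𝔞·𝔓_S + o(𝔞𝔓_S)` — the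
analogue of `KnifeEdge.InClassMean` for the linearised family. [cite: Zhang2022LandauSiegel, §7 Prop 7.1, §8 (8.23); TaoTeravainen2021, §5] -/
def SiegelInClassMean : Prop :=
  ∀ (u u' : ℝ → ℂ), KinkedProfile u u' → ∀ ε : ℝ, 0 < ε → ForAllLarge fun D _ χ => AssumptionA D χ →
    |discMeanS c' χ ψc (fun y t => profPolyS χ y u (⌊bigP D⌋₊ + 1) t) - mainTermForm u u' * frakA χ * frakPS D χ ψc|
      ≤ ε * frakA χ * frakPS D χ ψc

/-- **SIEGEL CROSS SLOT (shape, NOT asserted — the card's K2 «SiegelDivisorSwitch» object: the off-diagonal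
main term of the LINEARISED family at `θ ∈ (1,2)`):** under (A), eventually in `D`, the Siegel family's polar pairing
of (polynomial of `u`, length `P`) and (block of `v` on `⌈P⌉ ≤ n < ⌈P^θ⌉`) is `crossCoeff θ X u u′ v v′·𝔞·𝔓_S + o(𝔞𝔓_S)`
for `u` in class, `v ∈ 𝒱` — the analogue of `KnifeEdge.CrossMean c' θ X 𝒱`; composite-moduli technology (CIS divisor
switching, dispersion) is what the card proposes to evaluate THIS with. [cite: Zhang2022LandauSiegel, §7 (7.2), §8 (8.5), (8.11)–(8.12); TaoTeravainen2021, §5] -/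
def SiegelCrossMean (θ : ℝ) (X : PairFunctional) (𝒱 : (ℝ → ℂ) → (ℝ → ℂ) → Prop) : Prop :=
  ∀ (u u' v v' : ℝ → ℂ), InClassPiece u u' → 𝒱 v v' → ∀ ε : ℝ, 0 < ε →
    ForAllLarge fun D _ χ => AssumptionA D χ →
      ‖discPolarS c' χ ψc (fun y t => profPolyS χ y u (⌊bigP D⌋₊ + 1) t)
            (fun y t => blockPolyS χ y ⌈bigP D⌉₊ ⌈bigP D ^ θ⌉₊ v t)
          - crossCoeff θ X u u' v v' * frakA χ * frakPS D χ ψc‖ ≤ ε * frakA χ * frakPS D χ ψc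

/-- **SIEGEL OVERHANG SLOT (shape, NOT asserted):** under (A), eventually in `D`, the Siegel family's discrete mean of
the block of `v ∈ 𝒱` on `⌈P⌉ ≤ n < ⌈P^θ⌉` is `overhangConst θ X v v′·𝔞·𝔓_S + o(𝔞𝔓_S)` — the analogue of
`KnifeEdge.OverhangMean c' θ X 𝒱`. [cite: Zhang2022LandauSiegel, §7 (7.2), §8 (8.3); TaoTeravainen2021, §5] -/
def SiegelOverhangMean (θ : ℝ) (X : PairFunctional) (𝒱 : (ℝ → ℂ) → (ℝ → ℂ) → Prop) : Prop :=
  ∀ (v v' : ℝ → ℂ), 𝒱 v v' → ∀ ε : ℝ, 0 < ε → ForAllLarge fun D _ χ => AssumptionA D χ →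
    |discMeanS c' χ ψc (fun y t => blockPolyS χ y ⌈bigP D⌉₊ ⌈bigP D ^ θ⌉₊ v t)
        - overhangConst θ X v v' * frakA χ * frakPS D χ ψc| ≤ ε * frakA χ * frakPS D χ ψc

variable {ψc}

/-- **SUP HYPOTHESIS for the in-class block (bare `Prop`; the referee's currency condition «sup ≤ 𝓛^{c−1}·avg»):**
under (A), eventually, at EVERY modulus `m` of the window (prime or not) the `Ψ₁(m)`-slice of the discrete mean of the
length-`P` polynomial of `u` is `≤ 𝓛^κ·𝔞·P` in absolute value — at most `𝓛^κ` times one prime modulus's share `𝔞·p`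
of the main term `𝔅(u)𝔞𝔓`. In range (`n ≤ P < m`) this is the expected size up to `𝓛^{O(1)}`; asserted by no one.
[cite: Zhang2022LandauSiegel, §7 Prop 7.1, §8 (8.3)] -/
def InClassSliceSup (κ : ℝ) : Prop :=
  ∀ (u u' : ℝ → ℂ), KinkedProfile u u' → ForAllLarge fun D _ χ => AssumptionA D χ →
    ∀ m ∈ moduliWindow D, |modMean c' χ (fun y t => profPolyS χ y u (⌊bigP D⌋₊ + 1) t) m|
      ≤ ell D ^ κ * frakA χ * bigP D

/-- **SUP HYPOTHESIS for the cross block (bare `Prop`):** under (A), eventually, at EVERY modulus of the window the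
`Ψ₁(m)`-slice of the bulk × overhang polar pairing is `≤ 𝓛^κ·𝔞·P`. BEYOND THE WALL (`θ > 1`) this is NOT known a
priori: the additive large sieve gives the slice only `≲ (P^{θ−1} + 1)·(diagonal share)` per modulus (ls-ref-1
2026-08-26T21:21Z: a pointwise-in-modulus bound of this strength past the wall is itself E*-len⁺-strength); the
transfer theorems below display it as the hypothesis it is. [cite: Zhang2022LandauSiegel, §7 (7.2), §8 (8.5)] -/
def CrossSliceSup (κ θ : ℝ) (𝒱 : (ℝ → ℂ) → (ℝ → ℂ) → Prop) : Prop :=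
  ∀ (u u' v v' : ℝ → ℂ), InClassPiece u u' → 𝒱 v v' → ForAllLarge fun D _ χ => AssumptionA D χ →
    ∀ m ∈ moduliWindow D,
      ‖modPolar c' χ (fun y t => profPolyS χ y u (⌊bigP D⌋₊ + 1) t)
          (fun y t => blockPolyS χ y ⌈bigP D⌉₊ ⌈bigP D ^ θ⌉₊ v t) m‖ ≤ ell D ^ κ * frakA χ * bigP D

/-- **SUP HYPOTHESIS for the overhang block (bare `Prop`):** under (A), eventually, at EVERY modulus of the window the
`Ψ₁(m)`-slice of the discrete mean of the overhang block of `v ∈ 𝒱` is `≤ 𝓛^κ·𝔞·P` (same caveat beyond the wall).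
[cite: Zhang2022LandauSiegel, §7 (7.2), §8 (8.3)] -/
def OverhangSliceSup (κ θ : ℝ) (𝒱 : (ℝ → ℂ) → (ℝ → ℂ) → Prop) : Prop :=
  ∀ (v v' : ℝ → ℂ), 𝒱 v v' → ForAllLarge fun D _ χ => AssumptionA D χ →
    ∀ m ∈ moduliWindow D, |modMean c' χ (fun y t => blockPolyS χ y ⌈bigP D⌉₊ ⌈bigP D ^ θ⌉₊ v t) m|
      ≤ ell D ^ κ * frakA χ * bigP D

end SiegelSlots

/-! ### Part 2 — THE CARD'S FIRST RUNG, PROVED AS AN IMPLICATION: K1 ∧ Siegel slot ∧ sup hypothesis ⇒ prime slot -/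

section SlotTransfer

variable {c' : ℝ}

/-- ε-bookkeeping of a transfer: prime vs Siegel form `≤ (ε/3)𝔞𝔓`, Siegel form vs its main term `≤ (ε/6)𝔞𝔓_S`,
normalisers `|𝔓 − 𝔓_S| ≤ min(1, ε/(6(‖k‖+1)))·𝔓` give prime form vs main term `≤ ε𝔞𝔓`. [folklore] -/
private theorem transfer_bookkeeping {ε 𝔞 𝔓 𝔓S : ℝ} {A AS k : ℂ} (h𝔞 : 0 ≤ 𝔞) (h𝔓 : 0 ≤ 𝔓)
    (h1 : ‖A - AS‖ ≤ ε / 3 * 𝔞 * 𝔓) (h2 : ‖AS - k * 𝔞 * 𝔓S‖ ≤ ε / 6 * 𝔞 * 𝔓S)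
    (h3 : |𝔓 - 𝔓S| ≤ min 1 (ε / (6 * (‖k‖ + 1))) * 𝔓) (hε : 0 < ε) :
    ‖A - k * 𝔞 * 𝔓‖ ≤ ε * 𝔞 * 𝔓 := by
  have hk0 : 0 ≤ ‖k‖ := norm_nonneg k
  have h31 : |𝔓 - 𝔓S| ≤ 𝔓 := h3.trans (by nlinarith [min_le_left 1 (ε / (6 * (‖k‖ + 1)))])
  have h32 : |𝔓 - 𝔓S| ≤ ε / (6 * (‖k‖ + 1)) * 𝔓 :=
    h3.trans (mul_le_mul_of_nonneg_right (min_le_right _ _) h𝔓)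
  have hPS : 𝔓S ≤ 2 * 𝔓 := by have := (abs_sub_le_iff.mp h31).2; linarith
  have hkk : ‖k * 𝔞 * 𝔓S - k * 𝔞 * 𝔓‖ ≤ ε / 6 * 𝔞 * 𝔓 := by
    have hfac : k * 𝔞 * 𝔓S - k * 𝔞 * 𝔓 = k * ((𝔞 * (𝔓S - 𝔓) : ℝ) : ℂ) := by push_cast; ring
    rw [hfac, norm_mul, Complex.norm_real, Real.norm_eq_abs, abs_mul, abs_of_nonneg h𝔞, abs_sub_comm]
    have hk1 : ‖k‖ * (ε / (6 * (‖k‖ + 1))) ≤ ε / 6 := by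
      rw [mul_div_assoc', div_le_div_iff₀ (by positivity) (by norm_num)]
      nlinarith
    calc ‖k‖ * (𝔞 * |𝔓 - 𝔓S|) ≤ ‖k‖ * (𝔞 * (ε / (6 * (‖k‖ + 1)) * 𝔓)) :=
          mul_le_mul_of_nonneg_left (mul_le_mul_of_nonneg_left h32 h𝔞) hk0
      _ = ‖k‖ * (ε / (6 * (‖k‖ + 1))) * 𝔞 * 𝔓 := by ring
      _ ≤ ε / 6 * 𝔞 * 𝔓 := by
          have : 0 ≤ 𝔞 * 𝔓 := mul_nonneg h𝔞 h𝔓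
          nlinarith
  calc ‖A - k * 𝔞 * 𝔓‖ = ‖(A - AS) + (AS - k * 𝔞 * 𝔓S) + (k * 𝔞 * 𝔓S - k * 𝔞 * 𝔓)‖ := by ring_nf
    _ ≤ ‖A - AS‖ + ‖AS - k * 𝔞 * 𝔓S‖ + ‖k * 𝔞 * 𝔓S - k * 𝔞 * 𝔓‖ := norm_add₃_le
    _ ≤ ε / 3 * 𝔞 * 𝔓 + ε / 6 * 𝔞 * 𝔓S + ε / 6 * 𝔞 * 𝔓 := by linarith
    _ ≤ ε / 3 * 𝔞 * 𝔓 + ε / 6 * 𝔞 * (2 * 𝔓) + ε / 6 * 𝔞 * 𝔓 := by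
        have : 0 ≤ ε / 6 * 𝔞 := by positivity
        nlinarith
    _ ≤ ε * 𝔞 * 𝔓 := by nlinarith [mul_nonneg h𝔞 h𝔓]

/-- **CROSS SLOT TRANSFER (proved): K1 with exponent `c > 0`, the Siegel cross slot for `(ψc, θ, X, 𝒱)` and the
cross sup hypothesis with `κ < c` give Zhang's prime-family cross slot `KnifeEdge.CrossMean c' θ X 𝒱`** — the card's
implication «linearise the family index under (A), evaluate the composite family, come back to the primes» as a
kernel implication with every hypothesis named; `CrossMean` then composes into E-002 by `eStarLenPlusShape_of_slots`.
Nothing here asserts K1, the Siegel slot or the sup hypothesis. [cite: Zhang2022LandauSiegel, §7 (7.2), §8 (8.5); TaoTeravainen2021, §5 Prop. 5.2] -/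
theorem crossMean_of_siegel {c κ θ : ℝ} {X : PairFunctional} {𝒱 : (ℝ → ℂ) → (ℝ → ℂ) → Prop}
    (hc : 0 < c) (hκ : κ < c) (hK : SiegelModuliTransfer c) {ψc : ℝ → ℝ} (hψ : IsSmoothCutoff ψc)
    (hS : SiegelCrossMean c' ψc θ X 𝒱) (hsup : CrossSliceSup c' κ θ 𝒱) : CrossMean c' θ X 𝒱 := by
  intro u u' v v' hu hv ε hε
  set k : ℂ := crossCoeff θ X u u' v v' with hk
  have hε3 : 0 < ε / 3 := by positivity
  have hε6 : 0 < ε / 6 := by positivity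
  have hε' : 0 < min 1 (ε / (6 * (‖k‖ + 1))) := lt_min one_pos (by positivity)
  refine ((((hK.discPolar_transfer_of_sliceSup hκ hψ c' hε3).and (hS u u' v v' hu hv _ hε6)).and
    (hK.frakPS_rel hc hψ hε')).and (hsup u u' v v' hu hv)).mono fun D _ χ _ _ hh hA => ?_
  obtain ⟨⟨⟨h1, h2⟩, h3⟩, h4⟩ := hh
  have key := h1 hA (fun y t => profPolyS χ y u (⌊bigP D⌋₊ + 1) t)
    (fun y t => blockPolyS χ y ⌈bigP D⌉₊ ⌈bigP D ^ θ⌉₊ v t) (h4 hA)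
  have e2 := h2 hA
  rw [show ε / 6 * frakA χ * frakPS D χ ψc = ε / 6 * frakA χ * frakPS D χ ψc from rfl] at e2
  exact transfer_bookkeeping (frakA_nonneg χ) (frakP_nonneg D) key
    (by simpa only [mul_assoc] using e2) (h3 hA) hε

/-- **OVERHANG SLOT TRANSFER (proved):** K1 (`c > 0`), the Siegel overhang slot and the overhang sup hypothesis
(`κ < c`) give `KnifeEdge.OverhangMean c' θ X 𝒱`. [cite: Zhang2022LandauSiegel, §7 (7.2), §8 (8.3); TaoTeravainen2021, §5 Prop. 5.2] -/
theorem overhangMean_of_siegel {c κ θ : ℝ} {X : PairFunctional} {𝒱 : (ℝ → ℂ) → (ℝ → ℂ) → Prop}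
    (hc : 0 < c) (hκ : κ < c) (hK : SiegelModuliTransfer c) {ψc : ℝ → ℝ} (hψ : IsSmoothCutoff ψc)
    (hS : SiegelOverhangMean c' ψc θ X 𝒱) (hsup : OverhangSliceSup c' κ θ 𝒱) : OverhangMean c' θ X 𝒱 := by
  intro v v' hv ε hε
  set k : ℝ := overhangConst θ X v v' with hk
  have hε3 : 0 < ε / 3 := by positivity
  have hε6 : 0 < ε / 6 := by positivity
  have hε' : 0 < min 1 (ε / (6 * (‖(k : ℂ)‖ + 1))) := lt_min one_pos (by positivity)
  refine ((((hK.discMean_transfer_of_sliceSup hκ hψ c' hε3).and (hS v v' hv _ hε6)).and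
    (hK.frakPS_rel hc hψ hε')).and (hsup v v' hv)).mono fun D _ χ _ _ hh hA => ?_
  obtain ⟨⟨⟨h1, h2⟩, h3⟩, h4⟩ := hh
  have key := h1 hA (fun y t => blockPolyS χ y ⌈bigP D⌉₊ ⌈bigP D ^ θ⌉₊ v t) (h4 hA)
  have e2 := h2 hA
  have hb := transfer_bookkeeping (A := (discMean c' χ (fun x t => blockPoly χ x ⌈bigP D⌉₊ ⌈bigP D ^ θ⌉₊ v t) : ℂ))
    (AS := (discMeanS c' χ ψc (fun y t => blockPolyS χ y ⌈bigP D⌉₊ ⌈bigP D ^ θ⌉₊ v t) : ℂ)) (k := (k : ℂ))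
    (frakA_nonneg χ) (frakP_nonneg D) ?_ ?_ (h3 hA) hε
  · rw [← Complex.ofReal_mul, ← Complex.ofReal_mul, ← Complex.ofReal_sub, Complex.norm_real, Real.norm_eq_abs] at hb
    exact hb
  · rw [← Complex.ofReal_sub, Complex.norm_real, Real.norm_eq_abs]
    exact key
  · rw [← Complex.ofReal_mul, ← Complex.ofReal_mul, ← Complex.ofReal_sub, Complex.norm_real, Real.norm_eq_abs]
    exact e2

/-- **IN-CLASS SLOT TRANSFER (proved):** K1 (`c > 0`), the Siegel in-class slot and the in-class sup hypothesis
(`κ < c`) give `KnifeEdge.InClassMean c'`. [cite: Zhang2022LandauSiegel, §7 Prop 7.1, §8 (8.23); TaoTeravainen2021, §5 Prop. 5.2] -/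
theorem inClassMean_of_siegel {c κ : ℝ} (hc : 0 < c) (hκ : κ < c) (hK : SiegelModuliTransfer c) {ψc : ℝ → ℝ}
    (hψ : IsSmoothCutoff ψc) (hS : SiegelInClassMean c' ψc) (hsup : InClassSliceSup c' κ) : InClassMean c' := by
  intro u u' hu ε hε
  set k : ℝ := mainTermForm u u' with hk
  have hε3 : 0 < ε / 3 := by positivity
  have hε6 : 0 < ε / 6 := by positivity
  have hε' : 0 < min 1 (ε / (6 * (‖(k : ℂ)‖ + 1))) := lt_min one_pos (by positivity)
  refine ((((hK.discMean_transfer_of_sliceSup hκ hψ c' hε3).and (hS u u' hu _ hε6)).and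
    (hK.frakPS_rel hc hψ hε')).and (hsup u u' hu)).mono fun D _ χ _ _ hh hA => ?_
  obtain ⟨⟨⟨h1, h2⟩, h3⟩, h4⟩ := hh
  have key := h1 hA (fun y t => profPolyS χ y u (⌊bigP D⌋₊ + 1) t) (h4 hA)
  have e2 := h2 hA
  have hb := transfer_bookkeeping (A := (discMean c' χ (fun x t => profPoly χ x u (⌊bigP D⌋₊ + 1) t) : ℂ))
    (AS := (discMeanS c' χ ψc (fun y t => profPolyS χ y u (⌊bigP D⌋₊ + 1) t) : ℂ)) (k := (k : ℂ))
    (frakA_nonneg χ) (frakP_nonneg D) ?_ ?_ (h3 hA) hε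
  · rw [← Complex.ofReal_mul, ← Complex.ofReal_mul, ← Complex.ofReal_sub, Complex.norm_real, Real.norm_eq_abs] at hb
    exact hb
  · rw [← Complex.ofReal_sub, Complex.norm_real, Real.norm_eq_abs]
    exact key
  · rw [← Complex.ofReal_mul, ← Complex.ofReal_mul, ← Complex.ofReal_sub, Complex.norm_real, Real.norm_eq_abs]
    exact e2

/-- **The card's len rung composed into the row of record E-002:** for `θ ≥ 1` and a class `𝒱` of pieces vanishing
below the wall, K1 (`c > 0`) together with the three Siegel slots for `ψc` and the three sup hypotheses (`κ < c`)
gives `KnifeEdge.EStarLenPlusShape c' θ X 𝒱` (via `eStarLenPlusShape_of_slots`). Every hypothesis is OPEN and named;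
this is bookkeeping, not evidence. [cite: Zhang2022LandauSiegel, §7 Prop 7.1 (7.2), §8 (8.3)–(8.5), (8.23); TaoTeravainen2021, §5] -/
theorem eStarLenPlusShape_of_siegel {c κ θ : ℝ} (hθ : 1 ≤ θ) {X : PairFunctional}
    {𝒱 : (ℝ → ℂ) → (ℝ → ℂ) → Prop} (h𝒱 : ∀ v v', 𝒱 v v' → ∀ y, y < 1 → v y = 0)
    (hc : 0 < c) (hκ : κ < c) (hK : SiegelModuliTransfer c) {ψc : ℝ → ℝ} (hψ : IsSmoothCutoff ψc)
    (hB : SiegelInClassMean c' ψc) (hC : SiegelCrossMean c' ψc θ X 𝒱) (hO : SiegelOverhangMean c' ψc θ X 𝒱)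
    (sB : InClassSliceSup c' κ) (sC : CrossSliceSup c' κ θ 𝒱) (sO : OverhangSliceSup c' κ θ 𝒱) :
    EStarLenPlusShape c' θ X 𝒱 :=
  eStarLenPlusShape_of_slots hθ h𝒱 (inClassMean_of_siegel hc hκ hK hψ hB sB)
    (crossMean_of_siegel hc hκ hK hψ hC sC) (overhangMean_of_siegel hc hκ hK hψ hO sO)

end SlotTransfer

end Literature.NumberTheory.LFunctions.Zhang2022.KnifeEdge

end
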